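import Literature.Computability.MetaComplexity.MCSPUniversalInverterReduction
import Literature.Computability.Cryptography.OracleStretchReduction
import HarnessLib

/-!
# `MCSP` as a universal inverter from MILDLY NON-UNIFORM, ONE-BIT-STRETCH relativised HILL (proof)

`MCSPUniversalInverterReduction.lean` proves the named fact `AllenderEtAl2006_MCSP_universalInverter`
(Allender–Buhrman–Koucký–van Melkebeek–Ronneburger 2006, Thm. 45 with §4.2: an `MCSP` oracle inverts
every polynomial-time length-preserving `f_y` on average at every length) from the hypothesis `hHILL` —
ABK⁺06 Thm. 44, the relativised UNIFORM, LENGTH-DOUBLING HILL reduction for the dense `MCSP` test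
`L = (MCSPSize ⌊√(2ⁿ)⌋)ᶜ`. Håstad–Impagliazzo–Levin–Luby 1999 reach that statement in three moves their
paper keeps separate: (i) a MILDLY NON-UNIFORM pseudorandom generator `g(aₙ, ·)` from any one-way
function, stretching by ONE bit, with a weak-preserving mildly non-uniform oracle-machine reduction
(HILL Thm. 6.2.1 + §4.7 + §4.6 = Thm. 7.0.5; Def. 2.3.3, Def. 3.6.1: "`g^{(·)}` and `M^{(·)}` are both
allowed access to an integer-valued polynomial parameter `aₙ` that depends on `f`"), (ii) Prop. 3.3.4
(stretching), (iii) Prop. 4.8.1 (exclusive-or over all advice values, removing the non-uniformity).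
Against the `MCSP` test, (ii) and (iii) are not needed on the HILL side: the test breaks EVERY
polynomial-time generator family uniformly in its parameter (`mcspTest_breaks_generators`), hence every
advice candidate at once, and inversion of `f_y` tolerates guessing the advice. This file proves the
named fact from the correspondingly WEAKER hypothesis `hMNU` — move (i) alone, relativised to `L`, at
every length, with one-sided gaps:

> for every `F ∈ FP` with length-preserving sections there are `G ∈ FP` and polynomials `d ≥ id`, `A`
> such that for every PPT oracle adversary `M` and positive polynomial `p` there are a PPT oracle
> adversary `N`, a positive polynomial `q` and a threshold `n₀` with: for every `n ≥ n₀` and `y` SOME advice `a ≤ A(n)` has —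
> writing `u = ⟨⟨y, 1ⁿ⟩, 1ᵃ⟩` — a common output length `|G ⟨u, t⟩| = ℓ ≥ d(n) + 1` for `|t| = d(n)`, and
> `Pr_{z←U_ℓ}[M^L⟨u, z⟩ = 1] − Pr_{t←U_{d(n)}}[M^L⟨u, G⟨u,t⟩⟩ = 1] ≥ 1/p(n)` implies that `N^L`,
> given `⟨u, f_y(x)⟩` for a uniform `x ∈ {0,1}ⁿ`, outputs an `f_y`-preimage with probability `≥ 1/q(n)`

(`mcsp_universalInverter_of_mnuHILL`). The proof, on the `MCSP` side only: normalise the candidates to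
one-bit stretchers (their `(d(n)+1)`-prefixes) and iterate them to the length-doubling family `OStretch.gen2 G` (Goldreich
Constr. 3.3.2 with the context `u`, `OracleStretchReduction.lean`); the dense `MCSP` test breaks that
family at every parameter `u` of polynomial length (`mcspTest_breaks_generators`, `exists_tableFunction`);
the relativised exact hybrid reduction (`OStretch.exists_oneStep_distinguisher`) turns the breaker into
a one-step distinguisher with one-sided gap `≥ 1/(32 D(ℓ)⁴ (4ℓ+1))`, `ℓ = d(n)`, for EVERY advice `a`, which read through the prefix map `⟨u, w⟩ ↦ ⟨u, w ↾ (d(n)+1)⟩` (`OracleAdversary.exists_ppt_outputPMF_precomp`) distinguishes the candidate's full output from `U_ℓ` with the same gap;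
`hMNU` yields the advice-reading inverter `N`; the final inverter guesses `a` from `|bin A(n)|` fresh
coins and inserts `1ⁿ` (randomised preprocessing, `OracleAdversary.exists_ppt_outputPMF_rprecomp`,
`OracleAdversaryCoinPrefix.lean`), losing the factor `2^{|bin A(n)|} ≤ 2A(n) + 1`; patching at `n = 0`
and the oracle transfer `P^{P^{MCSP}} = P^{MCSP}` are the tree's (`UniversalAvgInverter.of_eventually`,
`mcsp_universalInverter_of_exists_PRel`; the threshold `n₀` of `hMNU` is absorbed by the same patching). Theorems only; no new definitions or named facts. What
remains open for `AllenderEtAl2006_MCSP_universalInverter_holds` is exactly `hMNU`: HILL Thm. 7.0.5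
(from Thm. 6.2.1, Lemma 4.7.2, Thm. 4.6.4), relativised, per length.

## References

* E. Allender, H. Buhrman, M. Koucký, D. van Melkebeek, D. Ronneburger, *Power from random strings*,
  SIAM J. Comput. 35(6) (2006) [AllenderEtAl2006]: Thm. 44, Thm. 45 and its proof (pp. 23–24 of the
  author version), §4.2 (p. 24).
* J. Håstad, R. Impagliazzo, L. A. Levin, M. Luby, *A pseudorandom generator from any one-way function*,
  SIAM J. Comput. 28 (1999) [HastadImpagliazzoLevinLuby1999]: Def. 2.3.3 and Def. 3.1.1 (mildly
  non-uniform), Def. 3.6.1 (reductions), Prop. 3.3.4, Prop. 4.8.1, §4.9, Thm. 6.2.1, Thm. 6.2.2,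
  Thm. 7.0.5.
* O. Goldreich, *Foundations of Cryptography I*, CUP 2001: Construction 3.3.2, Thm. 3.3.3.
* E. Allender, B. Das, Inform. and Comput. 256 (2017) [AllenderDas2017]: Thm. 1 and the remark after it.
-/

namespace Literature.Computability.MetaComplexity

open _root_.Computability Complexity Complexity.Brick Cryptography Finset OStretch

/-! ### Averaging lemmas -/

/-- The normalised candidate is the `(|t|+1)`-prefix of the candidate's output when that output is long
enough. [folklore] -/
private theorem os_eq_take_adv (G : List Bool → List Bool) {c t : List Bool}
    (h : t.length + 1 ≤ (G (boolPair c t)).length) : os G c t = (G (boolPair c t)).take (t.length + 1) := by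
  rw [os, List.take_append_of_le_length h]

/-- Monotonicity of uniform averages. [folklore] -/
private theorem uniformAvg_mono_adv {k : ℕ} {f g : List Bool → ℝ} (h : ∀ x : List Bool, x.length = k → f x ≤ g x) :
    uniformAvg k f ≤ uniformAvg k g := by
  unfold uniformAvg
  exact div_le_div_of_nonneg_right (Finset.sum_le_sum fun v _ => h _ (by simp)) (by positivity)

/-- A constant factor comes out of a uniform average. [folklore] -/
private theorem uniformAvg_const_mul_adv (k : ℕ) (b : ℝ) (f : List Bool → ℝ) :
    uniformAvg k (fun x => b * f x) = b * uniformAvg k f := by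
  unfold uniformAvg
  rw [← Finset.mul_sum, mul_div_assoc]

/-- **The probability of guessing the advice**: for `a < 2^κ`, `κ ≤ K`, the fraction of coin strings
`c ∈ {0,1}^K` with `⟦c ↾ κ⟧ = a` is exactly `2^{−κ}`. [cite: HastadImpagliazzoLevinLuby1999, Prop. 4.8.1 (proof: "in particular it works when i = a_n")] -/
private theorem uniformAvg_guess {κ K a : ℕ} (hκ : κ ≤ K) (ha : a < 2 ^ κ) :
    uniformAvg K (fun c : List Bool => if bitsToNat (c.take κ) = a then (1 : ℝ) else 0) = 1 / 2 ^ κ := by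
  obtain ⟨e, rfl⟩ : ∃ e, K = κ + e := ⟨K - κ, by omega⟩
  rw [uniformAvg_take κ e (fun c₁ : List Bool => if bitsToNat c₁ = a then (1 : ℝ) else 0),
    uniformAvg_bitsToNat κ (fun m : ℕ => if m = a then (1 : ℝ) else 0)]
  congr 1
  rw [Finset.sum_ite_eq' (range (2 ^ κ)) a (fun _ => (1 : ℝ)), if_pos (mem_range.2 ha)]

/-! ### The theorem -/

open scoped Classical in
/-- **ABK⁺06 Thm. 45 for `MCSP` from mildly non-uniform, one-bit-stretch, relativised HILL.** Let
`L = (MCSPSize ⌊√(2ⁿ)⌋)ᶜ` (the dense `MCSP` test, in `P^{MCSP}`). Assume `hMNU` — HILL Thm. 7.0.5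
(the mildly non-uniform pseudorandom generator `g(aₙ, ·)` from any one-way function with its
weak-preserving mildly non-uniform reduction, Def. 3.6.1; = Thm. 6.2.1 + Lemma 4.7.2 + Thm. 4.6.4),
relativised to `L`, at every length, in ABK⁺06's parametrised form: for every `F ∈ FP` with
length-preserving sections there are a candidate family `G ∈ FP` (reading `⟨u, seed⟩`,
`u = ⟨⟨y, 1ⁿ⟩, 1ᵃ⟩`: parameter, level, advice), a seed-length polynomial `d` with `d(n) ≥ n` and an
advice bound `A` such that for every PPT oracle adversary `M` and positive polynomial `p` there are a
PPT oracle adversary `N`, a positive polynomial `q` and a threshold `n₀` with: for every `n ≥ n₀` and `y` there is an advice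
`a ≤ A(n)` for which the candidate of context `u = ⟨⟨y,1ⁿ⟩,1ᵃ⟩` maps `d(n)`-bit seeds to strings of a
common length `ℓ ≥ d(n) + 1` and, whenever `M^L` tells `⟨u, U_ℓ⟩` from `⟨u, G⟨u, U_{d(n)}⟩⟩` with one-sided advantage
`≥ 1/p(n)`, `N^L` given `⟨u, f_y(x)⟩` (`x ← U_n`) outputs an `f_y`-preimage of `f_y(x)` with probability
`≥ 1/q(n)`. Then `AllenderEtAl2006_MCSP_universalInverter` holds. (HILL's Prop. 3.3.4 and Prop. 4.8.1
are absorbed on the `MCSP` side: the test breaks every candidate, the inverter guesses the advice.)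
[cite: AllenderEtAl2006, Thm. 44, Thm. 45 (proof, pp. 23–24) and §4.2]
[cite: HastadImpagliazzoLevinLuby1999, Thm. 7.0.5 with Def. 3.6.1 (mildly non-uniform reductions), Prop. 3.3.4, Prop. 4.8.1]
[cite: Goldreich2001, Thm. 3.3.3] -/
theorem mcsp_universalInverter_of_mnuHILL
    (hMNU : ∀ (F : List Bool → List Bool), F ∈ FP →
      (∀ y x : List Bool, (F (boolPair y x)).length = x.length) →
      ∃ (G : List Bool → List Bool) (d A : Polynomial ℕ), G ∈ FP ∧ (∀ n, n ≤ d.eval n) ∧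
        ∀ (M : OracleAdversary Bool), M.IsPPT encodingBoolBool →
          ∀ p : Polynomial ℕ, (∀ n, 0 < p.eval n) →
            ∃ (N : OracleAdversary (List Bool)) (q : Polynomial ℕ) (n₀ : ℕ),
              N.IsPPT (encodingList Bool) ∧ (∀ n, 0 < q.eval n) ∧
              ∀ (n : ℕ) (y : List Bool), n₀ ≤ n → ∃ a ℓ : ℕ, a ≤ A.eval n ∧ d.eval n + 1 ≤ ℓ ∧
                (∀ t : List Bool, t.length = d.eval n →
                  (G (boolPair (boolPair (boolPair y (unaryEncodeNat n)) (unaryEncodeNat a)) t)).length = ℓ) ∧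
                ((1 : ℝ) / ((p.eval n : ℕ) : ℝ) ≤
                    uniformAvg ℓ (fun z =>
                      (M.outputPMF (Oracle.ofLanguage (MCSPSize fun n => Nat.sqrt (2 ^ n))ᶜ)
                        (boolPair (boolPair (boolPair y (unaryEncodeNat n)) (unaryEncodeNat a)) z)
                          (some true)).toReal) -
                    uniformAvg (d.eval n) (fun t =>
                      (M.outputPMF (Oracle.ofLanguage (MCSPSize fun n => Nat.sqrt (2 ^ n))ᶜ)
                        (boolPair (boolPair (boolPair y (unaryEncodeNat n)) (unaryEncodeNat a))
                          (G (boolPair (boolPair (boolPair y (unaryEncodeNat n)) (unaryEncodeNat a)) t)))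
                          (some true)).toReal) →
                  (1 : ℝ) / ((q.eval n : ℕ) : ℝ) ≤
                    oracleInvertProb (fun w => F (boolPair (fstF (fstF (fstF w))) (sndF w))) N
                      (Oracle.ofLanguage (MCSPSize fun n => Nat.sqrt (2 ^ n))ᶜ)
                      (boolPair (boolPair y (unaryEncodeNat n)) (unaryEncodeNat a)) n)) :
    AllenderEtAl2006_MCSP_universalInverter := by
  classical
  refine mcsp_universalInverter_of_exists_PRel
    ⟨(MCSPSize fun n => Nat.sqrt (2 ^ n))ᶜ, compl_MCSPSize_sqrt_mem_PRel, ?_⟩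
  set L : Oracle := Oracle.ofLanguage (MCSPSize fun n => Nat.sqrt (2 ^ n))ᶜ with hL
  refine UniversalAvgInverter.of_eventually fun F r hF hlen => ?_
  -- mildly non-uniform HILL for `F`
  obtain ⟨G, d, A, hG, hd, hred⟩ := hMNU F hF hlen
  -- the length-doubling family of the normalised candidates, and the machine breaking it
  have hGen : gen2 G ∈ FP := gen2_mem_FP G hG
  have hGen2 : ∀ u s : List Bool, (gen2 G (boolPair u s)).length = 2 * s.length := length_gen2 G
  obtain ⟨D, hD64, hB⟩ := mcspTest_breaks_generators hGen hGen2 (4 * r + 2 * Polynomial.X + A + 6)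
  obtain ⟨h, hhFP, hspec⟩ := exists_tableFunction hGen hGen2 D
  obtain ⟨M₂, hM₂, hgap₂⟩ := hB h hhFP hspec
  -- the one-step distinguisher, and its version reading only the first `d(n) + 1` bits
  obtain ⟨M₁, hM₁, hid⟩ := exists_oneStep_distinguisher (G₁ := G) hG M₂ hM₂
  obtain ⟨gt, hgtdef⟩ : ∃ gt : List Bool → List Bool, gt = fun Z =>
      boolPair (fstF Z) (Plumb.takeFn (boolPair (true :: Plumb.polyFn d (sndF (fstF (fstF Z)))) (sndF Z))) :=
    ⟨_, rfl⟩
  have hgtFP : gt ∈ FP := by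
    rw [hgtdef]
    exact PRGStretch.pair_mem_FP fstF_mem_FP (PRGStretch.comp_mem_FP' Plumb.takeFn_mem_FP
      (PRGStretch.pair_mem_FP (PRGStretch.comp_mem_FP' (cons_mem_FP true)
        (PRGStretch.comp_mem_FP' (Plumb.polyFn_mem_FP d)
          (PRGStretch.comp_mem_FP' sndF_mem_FP (PRGStretch.comp_mem_FP' fstF_mem_FP fstF_mem_FP))))
        sndF_mem_FP))
  have hgtval : ∀ (y : List Bool) (n a : ℕ) (w : List Bool),
      gt (boolPair (boolPair (boolPair y (unaryEncodeNat n)) (unaryEncodeNat a)) w) =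
        boolPair (boolPair (boolPair y (unaryEncodeNat n)) (unaryEncodeNat a)) (w.take (d.eval n + 1)) := by
    intro y n a w
    rw [hgtdef]
    simp only [fstF_boolPair, sndF_boolPair, Plumb.polyFn_apply, length_unaryEncodeNat,
      Plumb.takeFn_boolPair, List.length_cons, List.length_replicate]
  obtain ⟨M₁t, hM₁t, hM₁tlaw⟩ := M₁.exists_ppt_outputPMF_precomp hM₁ hgtFP
  -- its advantage polynomial `p(n) = 32 D(d n)⁴ (4 d n + 1)`
  set p : Polynomial ℕ := (32 * D ^ 4 * (4 * Polynomial.X + 1)).comp d with hp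
  have hpn : ∀ n, p.eval n = 32 * (D.eval (d.eval n)) ^ 4 * (4 * d.eval n + 1) := fun n => by
    simp [hp, Polynomial.eval_comp]
  have hppos : ∀ n, 0 < p.eval n := fun n => by
    rw [hpn]; have := hD64 (d.eval n); positivity
  obtain ⟨N, q, n₀, hN, hq, hinv⟩ := hred M₁t hM₁t p hppos
  -- the final inverter: guess the advice, insert the level
  obtain ⟨g, hgdef⟩ : ∃ g : List Bool → List Bool, g = fun Z =>
      boolPair (boolPair (boolPair (fstF (fstF Z)) (onesFn (sndF (fstF Z))))
        (binToUnaryFn (boolPair (true :: Plumb.polyFn A (sndF (fstF Z)))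
          (Plumb.takeFn (boolPair (Plumb.polyFn Polynomial.X (lenBinF (Plumb.polyFn A (sndF (fstF Z))))) (sndF Z))))))
        (sndF (fstF Z)) := ⟨_, rfl⟩
  have hgFP : g ∈ FP := by
    rw [hgdef]
    exact PRGStretch.pair_mem_FP (PRGStretch.pair_mem_FP
      (PRGStretch.pair_mem_FP (PRGStretch.comp_mem_FP' fstF_mem_FP fstF_mem_FP)
        (PRGStretch.comp_mem_FP' onesFn_mem_FP (PRGStretch.comp_mem_FP' sndF_mem_FP fstF_mem_FP)))
      (PRGStretch.comp_mem_FP' binToUnaryFn_mem_FP (PRGStretch.pair_mem_FP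
        (PRGStretch.comp_mem_FP' (cons_mem_FP true)
          (PRGStretch.comp_mem_FP' (Plumb.polyFn_mem_FP A) (PRGStretch.comp_mem_FP' sndF_mem_FP fstF_mem_FP)))
        (PRGStretch.comp_mem_FP' Plumb.takeFn_mem_FP (PRGStretch.pair_mem_FP
          (PRGStretch.comp_mem_FP' (Plumb.polyFn_mem_FP _) (PRGStretch.comp_mem_FP' lenBinF_mem_FP
            (PRGStretch.comp_mem_FP' (Plumb.polyFn_mem_FP A) (PRGStretch.comp_mem_FP' sndF_mem_FP fstF_mem_FP))))
          sndF_mem_FP)))))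
      (PRGStretch.comp_mem_FP' sndF_mem_FP fstF_mem_FP)
  -- value of the guess map: `g ⟨⟨y, v⟩, c⟩ = ⟨⟨⟨y, 1^{|v|}⟩, 1^{a(c)}⟩, v⟩`
  have hgval : ∀ y v c : List Bool, g (boolPair (boolPair y v) c) =
      boolPair (boolPair (boolPair y (unaryEncodeNat v.length))
        (unaryEncodeNat (min (bitsToNat (c.take (kap (A.eval v.length)))) (A.eval v.length + 1)))) v := by
    intro y v c
    rw [hgdef]
    simp only [fstF_boolPair, sndF_boolPair, Plumb.polyFn_apply, lenBinF_apply, List.length_replicate,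
      Polynomial.eval_X, Plumb.takeFn_boolPair, binToUnaryFn_boolPair, List.length_cons,
      OCM.unaryEncodeNat_eq_ones, onesFn, kap]
  obtain ⟨N', hN', -, hN'law⟩ := N.exists_ppt_outputPMF_rprecomp hN hgFP (A + 1)
  refine ⟨N', q * (2 * A + 1), max n₀ 1, hN', fun n => ?_, fun n y hn' hy => ?_⟩
  · have := hq n
    simp only [Polynomial.eval_mul, Polynomial.eval_add, Polynomial.eval_ofNat, Polynomial.eval_one]
    positivity
  have hn : 1 ≤ n := le_trans (le_max_right _ _) hn'
  -- the good advice at `(n, y)`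
  obtain ⟨a, ℓG, haA, hℓG, hGlen, himp⟩ := hinv n y (le_trans (le_max_left _ _) hn')
  set u : List Bool := boolPair (boolPair y (unaryEncodeNat n)) (unaryEncodeNat a) with hu
  set ℓ : ℕ := d.eval n with hℓ
  have hℓpos : 0 < ℓ := lt_of_lt_of_le hn (hd n)
  -- the gap of the breaking machine at parameter `u`
  have hulen : u.length ≤ (4 * r + 2 * Polynomial.X + A + 6).eval ℓ := by
    have h1 := TM2Iter.eval_mono r (hd n)
    have h2 := TM2Iter.eval_mono A (hd n)
    have h3 := hd n
    simp only [hu, length_boolPair, length_unaryEncodeNat, Polynomial.eval_add, Polynomial.eval_mul,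
      Polynomial.eval_ofNat, Polynomial.eval_X, ← hℓ] at *
    omega
  have hg₂ := hgap₂ ℓ hℓpos u hulen
  -- the one-step gap at `u`: the truncating distinguisher sees `U_{ℓ+1}` / the normalised candidate
  have hid' := hid L u ℓ
  have hU : uniformAvg ℓG (fun z => (M₁t.outputPMF L (boolPair u z) (some true)).toReal) =
      uniformAvg (ℓ + 1) (fun z => (M₁.outputPMF L (boolPair u z) (some true)).toReal) := by
    obtain ⟨e, he⟩ : ∃ e, ℓG = (ℓ + 1) + e := ⟨ℓG - (ℓ + 1), by omega⟩
    rw [he, ← uniformAvg_take (ℓ + 1) e (fun z => (M₁.outputPMF L (boolPair u z) (some true)).toReal)]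
    refine uniformAvg_congr fun z _ => ?_
    rw [hM₁tlaw, hu, hgtval]
  have hGt : uniformAvg ℓ (fun t => (M₁t.outputPMF L (boolPair u (G (boolPair u t))) (some true)).toReal) =
      uniformAvg ℓ (fun t => (M₁.outputPMF L (boolPair u (os G u t)) (some true)).toReal) := by
    refine uniformAvg_congr fun t ht => ?_
    rw [hM₁tlaw, hu, hgtval, ← hu, os_eq_take_adv G (by rw [hGlen t ht, ht]; exact hℓG), ht]
  have hgap₁ : (1 : ℝ) / ((p.eval n : ℕ) : ℝ) ≤
      uniformAvg ℓG (fun z => (M₁t.outputPMF L (boolPair u z) (some true)).toReal) -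
        uniformAvg ℓ (fun t => (M₁t.outputPMF L (boolPair u (G (boolPair u t))) (some true)).toReal) := by
    rw [hU, hGt, hid', hpn]
    have hD : (0 : ℝ) < 32 * ((D.eval ℓ : ℕ) : ℝ) ^ 4 := by have := hD64 ℓ; positivity
    have hk : (2 : ℝ) ^ kap (2 * ℓ) ≤ 4 * (ℓ : ℝ) + 1 := by
      have h0 : 2 ^ kap (2 * ℓ) ≤ 4 * ℓ + 1 := by have := two_pow_kap_le (2 * ℓ); omega
      exact_mod_cast h0
    have hkpos : (0 : ℝ) < 2 ^ kap (2 * ℓ) := by positivity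
    calc (1 : ℝ) / ((32 * D.eval (d.eval n) ^ 4 * (4 * d.eval n + 1) : ℕ) : ℝ)
        = (1 / (32 * ((D.eval ℓ : ℕ) : ℝ) ^ 4)) / (4 * (ℓ : ℝ) + 1) := by
          rw [← hℓ]; push_cast; rw [div_div]
      _ ≤ (1 / (32 * ((D.eval ℓ : ℕ) : ℝ) ^ 4)) / 2 ^ kap (2 * ℓ) :=
          div_le_div_of_nonneg_left (by positivity) hkpos hk
      _ ≤ _ := div_le_div_of_nonneg_right hg₂ hkpos.le
  -- hence `N` inverts at `u`
  have hinvN : (1 : ℝ) / ((q.eval n : ℕ) : ℝ) ≤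
      oracleInvertProb (fun w => F (boolPair (fstF (fstF (fstF w))) (sndF w))) N L u n := himp hgap₁
  -- the success of `N'`: an average over its guess of the success of `N`
  set κ : ℕ := kap (A.eval n) with hκ
  set K : ℕ := (A + 1).eval (boolPair y (ones n)).length with hK
  have hKx : ∀ x : List Bool, x.length = n → (A + 1).eval (boolPair y (F (boolPair y x))).length = K := by
    intro x hx
    simp only [hK, length_boolPair, hlen, hx, List.length_replicate]
  have hκK : κ ≤ K := by
    have h1 : κ ≤ A.eval n := OStretch.kap_le _
    have h2 : A.eval n ≤ A.eval (boolPair y (ones n)).length :=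
      TM2Iter.eval_mono A (by simp [length_boolPair])
    simp only [hK, Polynomial.eval_add, Polynomial.eval_one]
    omega
  -- the inversion probability of `N'` at `(y, x)` as an average over the guess coins
  have hNx : ∀ x : List Bool, x.length = n →
      oracleInvertProbAt F N' L y x =
        uniformAvg K (fun c => oracleInvertProbAt (fun w => F (boolPair (fstF (fstF (fstF w))) (sndF w))) N L
          (boolPair (boolPair y (unaryEncodeNat n))
            (unaryEncodeNat (min (bitsToNat (c.take κ)) (A.eval n + 1)))) x) := by
    intro x hx
    unfold oracleInvertProbAt
    rw [hN'law, hKx x hx]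
    refine uniformAvg_congr fun c _ => ?_
    have hFx : (F (boolPair y x)).length = n := by rw [hlen, hx]
    rw [hgval, hFx]
    simp only [fstF_boolPair, sndF_boolPair, hκ]
  -- lower bound by the runs that guessed `a`
  have hguess : ∀ c : List Bool, bitsToNat (c.take κ) = a →
      min (bitsToNat (c.take κ)) (A.eval n + 1) = a := fun c hc => by
    rw [hc]; exact min_eq_left (by omega)
  have haκ : a < 2 ^ κ := lt_of_le_of_lt haA (lt_two_pow_kap _)
  calc (1 : ℝ) / (((q * (2 * A + 1)).eval n : ℕ) : ℝ)
      ≤ (1 / ((q.eval n : ℕ) : ℝ)) * (1 / 2 ^ κ) := by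
        have hqpos : (0 : ℝ) < ((q.eval n : ℕ) : ℝ) := by exact_mod_cast hq n
        have hk : (2 : ℝ) ^ κ ≤ 2 * ((A.eval n : ℕ) : ℝ) + 1 := by exact_mod_cast two_pow_kap_le (A.eval n)
        have hkpos : (0 : ℝ) < 2 ^ κ := by positivity
        have hcast : (((q * (2 * A + 1)).eval n : ℕ) : ℝ) = ((q.eval n : ℕ) : ℝ) * (2 * ((A.eval n : ℕ) : ℝ) + 1) := by
          simp only [Polynomial.eval_mul, Polynomial.eval_add, Polynomial.eval_one, Polynomial.eval_ofNat]
          push_cast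
          ring
        rw [hcast, one_div_mul_one_div]
        exact one_div_le_one_div_of_le (mul_pos hqpos hkpos) (mul_le_mul_of_nonneg_left hk hqpos.le)
    _ = uniformAvg K (fun c => if bitsToNat (c.take κ) = a then (1 : ℝ) / ((q.eval n : ℕ) : ℝ) else 0) := by
        rw [← uniformAvg_guess hκK haκ, ← uniformAvg_const_mul_adv]
        refine uniformAvg_congr fun c _ => ?_
        split_ifs <;> simp
    _ ≤ uniformAvg K (fun c => uniformAvg n (fun x =>
          oracleInvertProbAt (fun w => F (boolPair (fstF (fstF (fstF w))) (sndF w))) N L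
            (boolPair (boolPair y (unaryEncodeNat n))
              (unaryEncodeNat (min (bitsToNat (c.take κ)) (A.eval n + 1)))) x)) := by
        refine uniformAvg_mono_adv fun c _ => ?_
        split_ifs with hc
        · rw [hguess c hc]
          exact hinvN
        · exact uniformAvg_nonneg fun x => oracleInvertProbAt_nonneg _ _ _ _ _
    _ = oracleInvertProb F N' L y n := by
        rw [uniformAvg_comm, oracleInvertProb]
        exact (uniformAvg_congr fun x hx => hNx x hx).symm

end Literature.Computability.MetaComplexity
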